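import Summits.KontsevichZagierPeriods.Zeta5Search.Certificates.RecordRayClassWindowsC16A
import HarnessLib

/-!
# ζ(5) search — the record ray's DENOMINATORS, XI-e (C16): the CLASS-LAW WINDOW LIST (p3 g6)

HONEST FRAMING: systematic search; no irrationality claim unless certified.

OUR work (Summit side; prover seat p3, generation 6).  `cwinsC16` = the concatenation of the 1 part lists (46 class-law windows) with
`cwinsC16_holds`.  Index `idx` of a kind-3/4 table row refers to this list.  Valuations of rationals; every `γ < 1` — no irrationality content.
-/

noncomputable section

namespace Summit.KontsevichZagierPeriods.Zeta5Search.RecordRay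

/-- All class-law windows of stage C16. -/
def cwinsC16 : List CWin := cwinsC16A

/-- **Every class-law window holds.** -/
theorem cwinsC16_holds : ∀ c ∈ cwinsC16, c.Holds := by
  unfold cwinsC16
  exact cwinsC16A_holds

end Summit.KontsevichZagierPeriods.Zeta5Search.RecordRay
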